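import Summits.CriticalPhenomena.PercolationContinuityZ3.Theorems.PercNearOneGluingNoHeavyLowerTailTformStarPackingDeficit
import Summits.CriticalPhenomena.PercolationContinuityZ3.Theorems.PercNearOneGluingNoHeavyLowerTailAttachedChampion
import HarnessLib

/-!
# `NoHeavyLowerTail` (stmt-CriticalPhenomena-4575) — the LIGHT-STAR INDUCTION: XZ at the champion for every graph whose
# non-relay vertices span a matching, and the crux reduced to light MULTI-star packing

Support file (prover `prim-hp-5`, hull-port cell, T-form calculus, gen 3; `--supports stmt-CriticalPhenomena-4575`).
No definitions, no named facts, no sorries.  `μ = prodBernoulli w` on `Fin n`, relays `A`, level `j`, `π(x)`, `π(B) = ⋃_{y∈B} π(y)`,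
`Φ(x) = μ{|π(x)| ≤ j}`, champion `q` of `w` (`Φ(a) ≤ Φ(q)`, `a ∈ A`); for an observer `o`: `N = |π(o)|`, `L = {1 ≤ N ≤ j}`,
`R_x = {|π(x)| ≤ j}`, `𝔸 = {1 ≤ N}`.  The DEFICIT FORM of the attached-champion inequality is
    XZ⁺(w, o, c):  `μ(L) + Φ(c) ≤ μ(R_c ∩ 𝔸) + Φ(q)`   (every relay `c`; for `c = q` it is `stub_attachedChampion`).

THE INDUCTION (`xzDeficit_induction`).  By the deficit star-packing transfer (`Theorems.starPacking_deficit`) at `o` with the reference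
`p` = a champion of `K = G − o`, XZ⁺(w, o, c) follows from the packing inequality PST_B(p, c) in `K` at every nonempty star `B` of `o`:
stars with a member no `K`-lighter than `p` are `CutObserver.unguardedStability_of_member`; a LIGHT SINGLETON star `{y}` (a non-relay
gate `K`-lighter than `p`) needs exactly XZ⁺(K, y, c) — the same statement in the graph with the pairs at `o` deleted (fewer positive
pairs: induction); a LIGHT MULTI-STAR (`|B| ≥ 2`, all members non-relay and `K`-lighter than `p`) needs the light-star packing
inequality LSP at `B` in `K` (hypothesis `hLSP2`, stated for an arbitrary class `C` of weighted relay-graphs closed under deleting the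
pairs at a vertex).  Hence:

* `xzDeficit_induction` — for every class `C` closed under vertex-pair deletion on which LSP holds at light multi-stars: XZ⁺ on `C`.
* `attachedChampion_of_lightMultiStarPacking` / `noHeavyLowerTail_of_lightMultiStarPacking` — `C` = everything: **the registered stub
  `stub_attachedChampion`, and the crux, follow from LSP AT LIGHT MULTI-STARS ONLY** (`|B| ≥ 2`, all members non-relay and lighter
  than the champion; cf. `Theorems.noHeavyLowerTail_of_lightStarPacking`, which assumed all `|B| ≥ 1`).
* `attachedChampion_of_steinerMatching` — `C` = "every non-relay vertex has at most one non-relay positive-weight neighbour" (the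
  non-relay vertices span a matching; RELAY STRUCTURE ARBITRARY): light multi-stars never occur, so **XZ holds at every champion, for
  every observer, unconditionally** — hence CIL (`stub_cumulativeIsolation`) on this class (`cumulativeIsolation_of_steinerMatching`).
  This contains the relay-neighboured observers, the two-level stars of `Theorems.cil_oneSteiner` (there: CIL only, `x` relay-neighboured),
  and every "dumbbell" hull, with the sharper T-form and every champion as witness.
-/

noncomputable section

namespace Summit.CriticalPhenomena.PercolationContinuityZ3.Theorems

open MeasureTheory Set Literature.Probability.LatticeModels Literature.Probability.Percolation
open scoped Classical BigOperators

open CutObserver KNPreFKG in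
/-- **THE LIGHT-STAR INDUCTION.**  Let `C` be a class of weighted relay-graphs (`C n w A`) closed under deleting the pairs at a
vertex, and assume the light-star packing inequality on `C` at light MULTI-stars: for `w ∈ C`, an observer `o ∉ A`, a set `B`
of at least two non-relay positive-weight neighbours of `o`, and — in `u` = `w` with the pairs at `o` switched off — a champion
`q ∈ A` strictly heavier than every member of `B` and a relay `c`:
`μ_u(q ≁ B, 1 ≤ |π(B)| ≤ j) + μ_u(|π(B)| = 0, |π(c)| ≤ j) ≤ μ_u(q ≁ B, |π(q)| ≤ j)`.  Then for every `w ∈ C`, observer `o ∉ A`,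
champion `q` and relay `c`: `μ(1 ≤ N ≤ j) + μ(|π(c)| ≤ j) ≤ μ(|π(c)| ≤ j ∧ 1 ≤ N) + μ(|π(q)| ≤ j)` (XZ⁺).  Induction on the number of
positive-weight pairs. [cite: VandenbergHaggstromKahn2005, Thm. 1.5 (p. 7); KozmaNitzan2024, Lemma 5 (p. 13)] -/
theorem xzDeficit_induction
    (C : (n : ℕ) → (Sym2 (Fin n) → unitInterval) → Finset (Fin n) → Prop)
    (hC : ∀ (n : ℕ) (w : Sym2 (Fin n) → unitInterval) (A : Finset (Fin n)) (o : Fin n),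
      C n w A → C n (fun e => if e ∈ {e : Sym2 (Fin n) | o ∉ e} then w e else 0) A)
    (hLSP2 : ∀ (n : ℕ) (w : Sym2 (Fin n) → unitInterval) (A B : Finset (Fin n)) (o q c : Fin n) (j : ℕ),
      C n w A → o ∉ A → q ∈ A → c ∈ A → 2 ≤ B.card → (∀ y ∈ B, y ∉ A ∧ y ≠ o ∧ w s(o, y) ≠ 0) →
      (∀ a ∈ A, (prodBernoulli fun e => if e ∈ {e : Sym2 (Fin n) | o ∉ e} then w e else 0).real
          {ξ : BondConfig (Fin n) | (A.filter fun z => (openGraph ξ).Reachable a z).card ≤ j} ≤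
        (prodBernoulli fun e => if e ∈ {e : Sym2 (Fin n) | o ∉ e} then w e else 0).real
          {ξ : BondConfig (Fin n) | (A.filter fun z => (openGraph ξ).Reachable q z).card ≤ j}) →
      (∀ y ∈ B, (prodBernoulli fun e => if e ∈ {e : Sym2 (Fin n) | o ∉ e} then w e else 0).real
          {ξ : BondConfig (Fin n) | (A.filter fun z => (openGraph ξ).Reachable q z).card ≤ j} <
        (prodBernoulli fun e => if e ∈ {e : Sym2 (Fin n) | o ∉ e} then w e else 0).real
          {ξ : BondConfig (Fin n) | (A.filter fun z => (openGraph ξ).Reachable y z).card ≤ j}) →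
      (prodBernoulli fun e => if e ∈ {e : Sym2 (Fin n) | o ∉ e} then w e else 0).real {ξ : BondConfig (Fin n) |
          (∀ y ∈ B, ¬ (openGraph ξ).Reachable q y) ∧
            1 ≤ (A.filter fun z => ∃ y ∈ B, (openGraph ξ).Reachable y z).card ∧
            (A.filter fun z => ∃ y ∈ B, (openGraph ξ).Reachable y z).card ≤ j} +
        (prodBernoulli fun e => if e ∈ {e : Sym2 (Fin n) | o ∉ e} then w e else 0).real {ξ : BondConfig (Fin n) |
          ¬ 1 ≤ (A.filter fun z => ∃ y ∈ B, (openGraph ξ).Reachable y z).card ∧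
            (A.filter fun z => (openGraph ξ).Reachable c z).card ≤ j} ≤
      (prodBernoulli fun e => if e ∈ {e : Sym2 (Fin n) | o ∉ e} then w e else 0).real {ξ : BondConfig (Fin n) |
          (∀ y ∈ B, ¬ (openGraph ξ).Reachable q y) ∧ (A.filter fun z => (openGraph ξ).Reachable q z).card ≤ j}) :
    ∀ (m : ℕ) (n : ℕ) (w : Sym2 (Fin n) → unitInterval) (A : Finset (Fin n)) (o q c : Fin n) (j : ℕ),
      (Finset.univ.filter fun e : Sym2 (Fin n) => w e ≠ 0).card ≤ m → C n w A → o ∉ A → q ∈ A → c ∈ A →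
      (∀ a ∈ A, (prodBernoulli w).real {ω : BondConfig (Fin n) | (A.filter fun x => ω ∈ openConn a x).card ≤ j} ≤
        (prodBernoulli w).real {ω : BondConfig (Fin n) | (A.filter fun x => ω ∈ openConn q x).card ≤ j}) →
      (prodBernoulli w).real {ω : BondConfig (Fin n) |
          1 ≤ (A.filter fun x => ω ∈ openConn o x).card ∧ (A.filter fun x => ω ∈ openConn o x).card ≤ j} +
        (prodBernoulli w).real {ω : BondConfig (Fin n) | (A.filter fun x => ω ∈ openConn c x).card ≤ j} ≤
      (prodBernoulli w).real {ω : BondConfig (Fin n) |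
          (A.filter fun x => ω ∈ openConn c x).card ≤ j ∧ 1 ≤ (A.filter fun x => ω ∈ openConn o x).card} +
        (prodBernoulli w).real {ω : BondConfig (Fin n) | (A.filter fun x => ω ∈ openConn q x).card ≤ j} := by
  intro m
  induction m with
  | zero =>
    -- no positive pair at all: `N = 0` a.s., so `L` is null
    intro n w A o q c j hm hCw ho hq hc hchamp
    exact step n w A o q c j hCw ho hq hc hchamp (fun n' w' A' o' q' c' j' hlt => absurd hlt (by omega))
  | succ m ih =>
    intro n w A o q c j hm hCw ho hq hc hchamp
    exact step n w A o q c j hCw ho hq hc hchamp (fun n' w' A' o' q' c' j' hlt hC' ho' hq' hc' hch' =>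
      ih n' w' A' o' q' c' j' (by omega) hC' ho' hq' hc' hch')
  where
  /- the induction step, with the induction hypothesis available for every graph with FEWER positive pairs -/
  step (n : ℕ) (w : Sym2 (Fin n) → unitInterval) (A : Finset (Fin n)) (o q c : Fin n) (j : ℕ)
      (hCw : C n w A) (ho : o ∉ A) (hq : q ∈ A) (hc : c ∈ A)
      (hchamp : ∀ a ∈ A, (prodBernoulli w).real {ω : BondConfig (Fin n) | (A.filter fun x => ω ∈ openConn a x).card ≤ j} ≤
        (prodBernoulli w).real {ω : BondConfig (Fin n) | (A.filter fun x => ω ∈ openConn q x).card ≤ j})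
      (ih : ∀ (n' : ℕ) (w' : Sym2 (Fin n') → unitInterval) (A' : Finset (Fin n')) (o' q' c' : Fin n') (j' : ℕ),
        (Finset.univ.filter fun e : Sym2 (Fin n') => w' e ≠ 0).card <
          (Finset.univ.filter fun e : Sym2 (Fin n) => w e ≠ 0).card →
        C n' w' A' → o' ∉ A' → q' ∈ A' → c' ∈ A' →
        (∀ a ∈ A', (prodBernoulli w').real {ω : BondConfig (Fin n') | (A'.filter fun x => ω ∈ openConn a x).card ≤ j'} ≤
          (prodBernoulli w').real {ω : BondConfig (Fin n') | (A'.filter fun x => ω ∈ openConn q' x).card ≤ j'}) →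
        (prodBernoulli w').real {ω : BondConfig (Fin n') |
            1 ≤ (A'.filter fun x => ω ∈ openConn o' x).card ∧ (A'.filter fun x => ω ∈ openConn o' x).card ≤ j'} +
          (prodBernoulli w').real {ω : BondConfig (Fin n') | (A'.filter fun x => ω ∈ openConn c' x).card ≤ j'} ≤
        (prodBernoulli w').real {ω : BondConfig (Fin n') |
            (A'.filter fun x => ω ∈ openConn c' x).card ≤ j' ∧ 1 ≤ (A'.filter fun x => ω ∈ openConn o' x).card} +
          (prodBernoulli w').real {ω : BondConfig (Fin n') | (A'.filter fun x => ω ∈ openConn q' x).card ≤ j'}) :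
      (prodBernoulli w).real {ω : BondConfig (Fin n) |
          1 ≤ (A.filter fun x => ω ∈ openConn o x).card ∧ (A.filter fun x => ω ∈ openConn o x).card ≤ j} +
        (prodBernoulli w).real {ω : BondConfig (Fin n) | (A.filter fun x => ω ∈ openConn c x).card ≤ j} ≤
      (prodBernoulli w).real {ω : BondConfig (Fin n) |
          (A.filter fun x => ω ∈ openConn c x).card ≤ j ∧ 1 ≤ (A.filter fun x => ω ∈ openConn o x).card} +
        (prodBernoulli w).real {ω : BondConfig (Fin n) | (A.filter fun x => ω ∈ openConn q x).card ≤ j} := by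
    haveI : IsProbabilityMeasure (prodBernoulli w) := inferInstance
    set μ := prodBernoulli w with hμ
    set L := {ω : BondConfig (Fin n) |
      1 ≤ (A.filter fun x => ω ∈ openConn o x).card ∧ (A.filter fun x => ω ∈ openConn o x).card ≤ j} with hL
    set RcA := {ω : BondConfig (Fin n) |
      (A.filter fun x => ω ∈ openConn c x).card ≤ j ∧ 1 ≤ (A.filter fun x => ω ∈ openConn o x).card} with hRcA
    set sW : Fin n → ℝ := fun y => μ.real {ω : BondConfig (Fin n) |
      (A.filter fun z => (openGraph (ω ∩ {e | o ∉ e})).Reachable y z).card ≤ j} with hsW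
    set Γ : Finset (Fin n) := Finset.univ.filter fun v => v ≠ o ∧ w s(o, v) ≠ 0 with hΓ
    have hΓo : o ∉ Γ := by
      rw [hΓ, Finset.mem_filter]; exact fun h => h.2.1 rfl
    have hiso : ∀ v, v ≠ o → v ∉ Γ → w s(o, v) = 0 := by
      intro v hvo hvΓ
      by_contra hne
      exact hvΓ (Finset.mem_filter.2 ⟨Finset.mem_univ _, hvo, hne⟩)
    have hRcA0 : 0 ≤ μ.real RcA := measureReal_nonneg
    by_cases hΓe : Γ = ∅
    · -- #### no gate: `L` is null
      have hdecL := real_eq_sum_inter_starEvent w Γ o hΓo hiso L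
      rw [hΓe, Finset.powerset_empty, Finset.sum_singleton] at hdecL
      have h0 : L ∩ starEvent o ↑(∅ : Finset (Fin n)) = (∅ : Set (BondConfig (Fin n))) := by
        ext ω
        simp only [mem_inter_iff, mem_empty_iff_false, iff_false, not_and]
        intro hLω hσ
        rw [Finset.coe_empty] at hσ
        obtain ⟨x, hx⟩ := Finset.card_pos.1 (lt_of_lt_of_le Nat.zero_lt_one hLω.1)
        rw [Finset.mem_filter] at hx
        exact not_reachable_of_mem_starEvent_empty hσ (fun h => ho (h ▸ hx.1)) hx.2
      rw [h0, measureReal_empty] at hdecL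
      change μ.real L + _ ≤ μ.real RcA + _
      rw [hdecL]
      linarith [hchamp c hc]
    -- #### a gate exists: the weights `u` without the pairs at `o` have fewer positive pairs
    obtain ⟨y₀, hy₀⟩ := Finset.nonempty_iff_ne_empty.2 hΓe
    have hy₀' := Finset.mem_filter.1 hy₀
    set u : Sym2 (Fin n) → unitInterval := fun e => if e ∈ {e : Sym2 (Fin n) | o ∉ e} then w e else 0 with hu
    have hCu : C n u A := hC n w A o hCw
    have hlt : (Finset.univ.filter fun e : Sym2 (Fin n) => u e ≠ 0).card <
        (Finset.univ.filter fun e : Sym2 (Fin n) => w e ≠ 0).card := by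
      refine Finset.card_lt_card ⟨fun e he => ?_, fun hsub => ?_⟩
      · rw [Finset.mem_filter] at he ⊢
        refine ⟨he.1, fun hwe => he.2 ?_⟩
        simp only [hu, mem_setOf_eq]
        split_ifs <;> simp [hwe]
      · have hmem : s(o, y₀) ∈ (Finset.univ.filter fun e : Sym2 (Fin n) => w e ≠ 0) :=
          Finset.mem_filter.2 ⟨Finset.mem_univ _, hy₀'.2.2⟩
        have := Finset.mem_filter.1 (hsub hmem)
        apply this.2
        simp only [hu, mem_setOf_eq, Sym2.mem_iff, true_or, not_true_eq_false, if_false]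
    -- transfer of `K`-events to `prodBernoulli u`
    have e1 : ∀ x : Fin n, {ω : BondConfig (Fin n) |
          (A.filter fun z => (openGraph (ω ∩ {e | o ∉ e})).Reachable x z).card ≤ j} =
        {ω : BondConfig (Fin n) | ω ∩ {e | o ∉ e} ∈
          {ξ : BondConfig (Fin n) | (A.filter fun z => (openGraph ξ).Reachable x z).card ≤ j}} := fun x => rfl
    have hfilt : ∀ (x : Fin n) (ξ : BondConfig (Fin n)),
        (A.filter fun z => (openGraph ξ).Reachable x z) = (A.filter fun z => ξ ∈ openConn x z) :=
      fun x ξ => Finset.filter_congr fun _ _ => Iff.rfl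
    have eoc : ∀ (x : Fin n), {ξ : BondConfig (Fin n) | (A.filter fun z => (openGraph ξ).Reachable x z).card ≤ j} =
        {ξ : BondConfig (Fin n) | (A.filter fun z => ξ ∈ openConn x z).card ≤ j} := by
      intro x; ext ξ
      exact ⟨fun h => by rw [mem_setOf_eq] at h ⊢; rwa [← hfilt x ξ], fun h => by rw [mem_setOf_eq] at h ⊢; rwa [hfilt x ξ]⟩
    -- a champion `p` of `u`
    obtain ⟨p, hpA, hpmax⟩ := Finset.exists_max_image A sW ⟨q, hq⟩
    have hchampK : ∀ a ∈ A,
        (prodBernoulli u).real {ξ : BondConfig (Fin n) | (A.filter fun z => (openGraph ξ).Reachable a z).card ≤ j} ≤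
          (prodBernoulli u).real {ξ : BondConfig (Fin n) | (A.filter fun z => (openGraph ξ).Reachable p z).card ≤ j} := by
      intro a ha
      have h := hpmax a ha
      simp only [hsW] at h
      rw [e1 a, e1 p, measureReal_preimage_avoid, measureReal_preimage_avoid] at h
      exact h
    -- ### the deficit star-packing transfer with reference `p`
    have hmain := starPacking_deficit w A o p c j ho hpA hc ?_ (hpmax c hc)
    · exact le_trans hmain (by linarith [hchamp p hpA])
    -- ### the packing inequality at every nonempty star
    intro B hBne hB
    have eP1 : {ω : BondConfig (Fin n) |
          (∀ y ∈ B, ¬ (openGraph (ω ∩ {e | o ∉ e})).Reachable p y) ∧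
            1 ≤ (A.filter fun z => ∃ y ∈ B, (openGraph (ω ∩ {e | o ∉ e})).Reachable y z).card ∧
            (A.filter fun z => ∃ y ∈ B, (openGraph (ω ∩ {e | o ∉ e})).Reachable y z).card ≤ j} =
        {ω : BondConfig (Fin n) | ω ∩ {e | o ∉ e} ∈ {ξ : BondConfig (Fin n) |
          (∀ y ∈ B, ¬ (openGraph ξ).Reachable p y) ∧
            1 ≤ (A.filter fun z => ∃ y ∈ B, (openGraph ξ).Reachable y z).card ∧
            (A.filter fun z => ∃ y ∈ B, (openGraph ξ).Reachable y z).card ≤ j}} := rfl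
    have eP2 : {ω : BondConfig (Fin n) |
          ¬ 1 ≤ (A.filter fun z => ∃ y ∈ B, (openGraph (ω ∩ {e | o ∉ e})).Reachable y z).card ∧
            (A.filter fun z => (openGraph (ω ∩ {e | o ∉ e})).Reachable c z).card ≤ j} =
        {ω : BondConfig (Fin n) | ω ∩ {e | o ∉ e} ∈ {ξ : BondConfig (Fin n) |
          ¬ 1 ≤ (A.filter fun z => ∃ y ∈ B, (openGraph ξ).Reachable y z).card ∧
            (A.filter fun z => (openGraph ξ).Reachable c z).card ≤ j}} := rfl
    have eP3 : {ω : BondConfig (Fin n) |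
          (∀ y ∈ B, ¬ (openGraph (ω ∩ {e | o ∉ e})).Reachable p y) ∧
            (A.filter fun z => (openGraph (ω ∩ {e | o ∉ e})).Reachable p z).card ≤ j} =
        {ω : BondConfig (Fin n) | ω ∩ {e | o ∉ e} ∈ {ξ : BondConfig (Fin n) |
          (∀ y ∈ B, ¬ (openGraph ξ).Reachable p y) ∧
            (A.filter fun z => (openGraph ξ).Reachable p z).card ≤ j}} := rfl
    rw [eP1, eP2, eP3, measureReal_preimage_avoid, measureReal_preimage_avoid, measureReal_preimage_avoid]
    set ν := prodBernoulli u with hν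
    haveI : IsProbabilityMeasure ν := inferInstance
    -- notation for the `K`-counts
    set MB : BondConfig (Fin n) → ℕ := fun ξ => (A.filter fun z => ∃ y ∈ B, (openGraph ξ).Reachable y z).card with hMB
    set Lx : Fin n → BondConfig (Fin n) → ℕ := fun x ξ => (A.filter fun z => (openGraph ξ).Reachable x z).card with hLx
    change ν.real {ξ | (∀ y ∈ B, ¬ (openGraph ξ).Reachable p y) ∧ 1 ≤ MB ξ ∧ MB ξ ≤ j} +
        ν.real {ξ | ¬ 1 ≤ MB ξ ∧ Lx c ξ ≤ j} ≤ ν.real {ξ | (∀ y ∈ B, ¬ (openGraph ξ).Reachable p y) ∧ Lx p ξ ≤ j}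
    -- `|π(B)| = 0` forces `p ≁ B` (`p` is a relay)
    have hMB0 : ∀ ξ, ¬ 1 ≤ MB ξ → ∀ y ∈ B, ¬ (openGraph ξ).Reachable p y := by
      intro ξ h y hy hpy
      exact h (Finset.card_pos.2 ⟨p, Finset.mem_filter.2 ⟨hpA, y, hy, hpy.symm⟩⟩)
    by_cases hpB : p ∈ B
    · -- `p ∈ B`: `p ≁ B` is impossible and `|π(B)| ≥ 1`
      have h1 : ν.real {ξ | (∀ y ∈ B, ¬ (openGraph ξ).Reachable p y) ∧ 1 ≤ MB ξ ∧ MB ξ ≤ j} = 0 := by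
        have : {ξ | (∀ y ∈ B, ¬ (openGraph ξ).Reachable p y) ∧ 1 ≤ MB ξ ∧ MB ξ ≤ j} = (∅ : Set (BondConfig (Fin n))) := by
          ext ξ; simp only [mem_setOf_eq, mem_empty_iff_false, iff_false, not_and]
          intro h; exact absurd (SimpleGraph.Reachable.refl p) (h p hpB)
        rw [this, measureReal_empty]
      have h2 : ν.real {ξ | ¬ 1 ≤ MB ξ ∧ Lx c ξ ≤ j} = 0 := by
        have : {ξ | ¬ 1 ≤ MB ξ ∧ Lx c ξ ≤ j} = (∅ : Set (BondConfig (Fin n))) := by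
          ext ξ; simp only [mem_setOf_eq, mem_empty_iff_false, iff_false, not_and]
          intro h; exact absurd (SimpleGraph.Reachable.refl p) (hMB0 ξ h p hpB)
        rw [this, measureReal_empty]
      rw [h1, h2, add_zero]; exact measureReal_nonneg
    by_cases hdm : ∃ y ∈ B, sW y ≤ sW p
    · -- #### a member no `K`-lighter than `p`: unguarded stability
      obtain ⟨y, hyB, hy⟩ := hdm
      have hpy : p ≠ y := fun h => hpB (h ▸ hyB)
      have hle : ν.real {ξ : BondConfig (Fin n) | (A.filter fun z => (openGraph ξ).Reachable y z).card ≤ j} ≤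
          ν.real {ξ : BondConfig (Fin n) | (A.filter fun z => (openGraph ξ).Reachable p z).card ≤ j} := by
        have h := hy
        simp only [hsW] at h
        rw [e1 y, e1 p, measureReal_preimage_avoid, measureReal_preimage_avoid] at h
        exact h
      have key := unguardedStability_of_member u A B hyB hpy j hle
      change ν.real {ξ | (∀ m ∈ B, ¬ (openGraph ξ).Reachable p m) ∧ MB ξ ≤ j} ≤
        ν.real {ξ | (∀ m ∈ B, ¬ (openGraph ξ).Reachable p m) ∧ Lx p ξ ≤ j} at key
      -- the two left events are disjoint pieces of `{p ≁ B, |π(B)| ≤ j}`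
      have hdisj : Disjoint {ξ | (∀ y ∈ B, ¬ (openGraph ξ).Reachable p y) ∧ 1 ≤ MB ξ ∧ MB ξ ≤ j}
          {ξ | ¬ 1 ≤ MB ξ ∧ Lx c ξ ≤ j} := by
        rw [Set.disjoint_left]
        rintro ξ ⟨_, h1, _⟩ ⟨h2, _⟩
        exact h2 h1
      have hsub : {ξ | (∀ y ∈ B, ¬ (openGraph ξ).Reachable p y) ∧ 1 ≤ MB ξ ∧ MB ξ ≤ j} ∪
          {ξ | ¬ 1 ≤ MB ξ ∧ Lx c ξ ≤ j} ⊆ {ξ | (∀ m ∈ B, ¬ (openGraph ξ).Reachable p m) ∧ MB ξ ≤ j} := by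
        rintro ξ (⟨h1, _, h3⟩ | ⟨h1, _⟩)
        · exact ⟨h1, h3⟩
        · exact ⟨hMB0 ξ h1, by show MB ξ ≤ j; omega⟩
      have hu' := measureReal_union hdisj (MeasurableSet.of_discrete (s := {ξ | ¬ 1 ≤ MB ξ ∧ Lx c ξ ≤ j})) (μ := ν)
        (measure_ne_top _ _) (measure_ne_top _ _)
      rw [← hu']
      exact (measureReal_mono hsub (measure_ne_top _ _)).trans key
    · -- #### a LIGHT star: all members are non-relays strictly `K`-lighter than `p`
      push Not at hdm
      have hBA : ∀ y ∈ B, y ∉ A := by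
        intro y hy hyA
        exact absurd (hpmax y hyA) (not_le.2 (hdm y hy))
      have hlight : ∀ y ∈ B, ν.real {ξ : BondConfig (Fin n) | (A.filter fun z => (openGraph ξ).Reachable p z).card ≤ j} <
          ν.real {ξ : BondConfig (Fin n) | (A.filter fun z => (openGraph ξ).Reachable y z).card ≤ j} := by
        intro y hy
        have h := hdm y hy
        simp only [hsW] at h
        rw [e1 y, e1 p, measureReal_preimage_avoid, measureReal_preimage_avoid] at h
        exact h
      by_cases hcard : 2 ≤ B.card
      · -- light MULTI-star: the hypothesis
        exact hLSP2 n w A B o p c j hCw ho hpA hc hcard (fun y hy => ⟨hBA y hy, hB y hy⟩) hchampK hlight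
      · -- light SINGLETON star `{y}`: the induction hypothesis at the observer `y` in `u`
        obtain ⟨y, hyB⟩ := hBne
        have hB1 : B = {y} := by
          have hc1 : B.card = 1 := by
            have := Finset.card_pos.2 ⟨y, hyB⟩; omega
          obtain ⟨y', hy'⟩ := Finset.card_eq_one.1 hc1
          rw [hy'] at hyB ⊢; rw [Finset.mem_singleton.1 hyB]
        subst hB1
        have hyA : y ∉ A := hBA y hyB
        -- the induction hypothesis XZ⁺(u, y, c) with champion `p`
        have hchampK' : ∀ a ∈ A, ν.real {ξ : BondConfig (Fin n) | (A.filter fun z => ξ ∈ openConn a z).card ≤ j} ≤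
            ν.real {ξ : BondConfig (Fin n) | (A.filter fun z => ξ ∈ openConn p z).card ≤ j} := by
          intro a ha; rw [← eoc a, ← eoc p]; exact hchampK a ha
        have hIH := ih n u A y p c j hlt hCu hyA hpA hc hchampK'
        -- rewrite the IH in `Reachable` form
        have eL : {ξ : BondConfig (Fin n) |
              1 ≤ (A.filter fun z => ξ ∈ openConn y z).card ∧ (A.filter fun z => ξ ∈ openConn y z).card ≤ j} =
            {ξ | 1 ≤ Lx y ξ ∧ Lx y ξ ≤ j} := by
          ext ξ
          simp only [mem_setOf_eq, hLx, ← hfilt y ξ]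
        have eA : {ξ : BondConfig (Fin n) |
              (A.filter fun z => ξ ∈ openConn c z).card ≤ j ∧ 1 ≤ (A.filter fun z => ξ ∈ openConn y z).card} =
            {ξ | Lx c ξ ≤ j ∧ 1 ≤ Lx y ξ} := by
          ext ξ
          simp only [mem_setOf_eq, hLx, ← hfilt y ξ, ← hfilt c ξ]
        rw [eL, eA, ← eoc c, ← eoc p] at hIH
        change ν.real {ξ | 1 ≤ Lx y ξ ∧ Lx y ξ ≤ j} + ν.real {ξ | Lx c ξ ≤ j} ≤
          ν.real {ξ | Lx c ξ ≤ j ∧ 1 ≤ Lx y ξ} + ν.real {ξ | Lx p ξ ≤ j} at hIH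
        -- `|π({y})| = |π(y)|`
        have hMy : ∀ ξ, MB ξ = Lx y ξ := by
          intro ξ
          simp only [hMB, hLx]
          congr 1
          refine Finset.filter_congr fun z _ => ⟨fun ⟨x, hx, hxz⟩ => ?_, fun h => ⟨y, Finset.mem_singleton_self y, h⟩⟩
          rw [Finset.mem_singleton.1 hx] at hxz; exact hxz
        -- μ{L_c ≤ j} = μ{L_c ≤ j, 1 ≤ L_y} + μ{¬ 1 ≤ L_y, L_c ≤ j}
        have hsplit := measureReal_inter_add_sdiff (μ := ν) (s := {ξ : BondConfig (Fin n) | Lx c ξ ≤ j})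
          (MeasurableSet.of_discrete (s := {ξ : BondConfig (Fin n) | 1 ≤ Lx y ξ})) (measure_ne_top _ _)
        have es1 : {ξ : BondConfig (Fin n) | Lx c ξ ≤ j} ∩ {ξ | 1 ≤ Lx y ξ} = {ξ | Lx c ξ ≤ j ∧ 1 ≤ Lx y ξ} := by
          ext ξ; simp only [mem_inter_iff, mem_setOf_eq]
        have es2 : {ξ : BondConfig (Fin n) | Lx c ξ ≤ j} \ {ξ | 1 ≤ Lx y ξ} = {ξ | ¬ 1 ≤ MB ξ ∧ Lx c ξ ≤ j} := by
          ext ξ; simp only [mem_sdiff, mem_setOf_eq, hMy]; exact and_comm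
        rw [es1, es2] at hsplit
        -- on `{p ↔ y}`: `L_p = L_y ≥ 1`, so the unrestricted and the restricted inequalities differ by the same mass
        have hsplitL := measureReal_inter_add_sdiff (μ := ν) (s := {ξ : BondConfig (Fin n) | 1 ≤ Lx y ξ ∧ Lx y ξ ≤ j})
          (MeasurableSet.of_discrete (s := {ξ : BondConfig (Fin n) | (openGraph ξ).Reachable p y})) (measure_ne_top _ _)
        have hsplitR := measureReal_inter_add_sdiff (μ := ν) (s := {ξ : BondConfig (Fin n) | Lx p ξ ≤ j})
          (MeasurableSet.of_discrete (s := {ξ : BondConfig (Fin n) | (openGraph ξ).Reachable p y})) (measure_ne_top _ _)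
        have hLp_eq : ∀ ξ, (openGraph ξ).Reachable p y → Lx p ξ = Lx y ξ := by
          intro ξ hpy'
          simp only [hLx]
          congr 1
          exact Finset.filter_congr fun z _ => ⟨fun h => hpy'.symm.trans h, fun h => hpy'.trans h⟩
        have hLy1 : ∀ ξ, (openGraph ξ).Reachable p y → 1 ≤ Lx y ξ := by
          intro ξ hpy'
          exact Finset.card_pos.2 ⟨p, Finset.mem_filter.2 ⟨hpA, hpy'.symm⟩⟩
        have eV : {ξ : BondConfig (Fin n) | 1 ≤ Lx y ξ ∧ Lx y ξ ≤ j} ∩ {ξ | (openGraph ξ).Reachable p y} =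
            {ξ : BondConfig (Fin n) | Lx p ξ ≤ j} ∩ {ξ | (openGraph ξ).Reachable p y} := by
          ext ξ
          simp only [mem_inter_iff, mem_setOf_eq]
          constructor
          · rintro ⟨⟨_, h2⟩, h3⟩; exact ⟨by rw [hLp_eq ξ h3]; exact h2, h3⟩
          · rintro ⟨h2, h3⟩; exact ⟨⟨hLy1 ξ h3, by rw [← hLp_eq ξ h3]; exact h2⟩, h3⟩
        have eDL : {ξ : BondConfig (Fin n) | 1 ≤ Lx y ξ ∧ Lx y ξ ≤ j} \ {ξ | (openGraph ξ).Reachable p y} =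
            {ξ | (∀ y' ∈ ({y} : Finset (Fin n)), ¬ (openGraph ξ).Reachable p y') ∧ 1 ≤ MB ξ ∧ MB ξ ≤ j} := by
          ext ξ
          simp only [mem_sdiff, mem_setOf_eq, Finset.mem_singleton, forall_eq, hMy]
          tauto
        have eDR : {ξ : BondConfig (Fin n) | Lx p ξ ≤ j} \ {ξ | (openGraph ξ).Reachable p y} =
            {ξ | (∀ y' ∈ ({y} : Finset (Fin n)), ¬ (openGraph ξ).Reachable p y') ∧ Lx p ξ ≤ j} := by
          ext ξ
          simp only [mem_sdiff, mem_setOf_eq, Finset.mem_singleton, forall_eq]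
          tauto
        rw [eV, eDL] at hsplitL
        rw [eDR] at hsplitR
        linarith

end Summit.CriticalPhenomena.PercolationContinuityZ3.Theorems

end
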